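import Summits.PneNP.PneNP.Theorems.PlantedCliquePlantedcliqueRecoveryGlueTest
import Summits.PneNP.PneNP.Theorems.PlantedcliqueIndistinguishable.Negative.FalseWithoutAdmissible

/-!
# Route PlantedClique — `PlantedcliqueRecoveryGlue` (stmt-PneNP-8689)

`PlantedcliqueIndistinguishable → ErdosRenyiNoLargeClique → PlantedcliqueThesis`. For `ε < 1/2` and a
PPT recovery algorithm `A`, the clique-checking test `T` of part 1 (threshold `t(n) = (⌊log₂ n⌋+2)²`)
has type-II error `≤ 1 - recoverProb A k_ε n` once `t(n) ≤ k_ε(n) = ⌈n^{1/2-ε}⌉ ≤ n` (the planted set is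
a `k_ε(n)`-clique) and type-I error at most the probability that `G(n,1/2)` has a clique of size `t(n)`,
which tends to `0` (`t(n) ≥ 3 log₂ n`); indistinguishability at `k_ε` (admissible: `k_ε(n) ≤ n^{1/2-ε/2}`)
then squeezes `recoverProb A k_ε n → 0`. Corner `ε ≥ 1/2` (`k_ε ≡ 1`): planting a singleton changes
nothing, so the recovery probability is `≤ 1/n`.
-/

set_option linter.dupNamespace false -- `Summit.PneNP.PneNP.…`: summit = sub-problem name (D-0017 single-conjunct layout)

namespace Summit.PneNP.PneNP.Theorems

open _root_.Computability Finset Filter Topology MeasureTheory Asymptotics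
open Literature.Computability.Complexity
open Literature.Probability.RandomGraphs Literature.Probability.RandomGraphs.PlantedClique

/-- The output law of the composed test is the push-forward of `A`'s output law under the check.
[folklore] -/
theorem recoveryGlue_outputPMF (A : RandAlg (List Bool) (List Bool)) (τ : List Bool × List Bool → Bool)
    (w : List Bool) :
    (RandAlg.mk (fun w r => τ (w, A.run w r)) A.coinLen).outputPMF id w =
      (A.outputPMF id w).map fun o => τ (w, o) := by
  unfold RandAlg.outputPMF
  rw [PMF.map_comp]
  rfl

/-- **Planted side**: recovering the planted set makes the test accept, so
`recoverProb A k n ≤ P_{planted}[T = 1]` once `t(n) ≤ min (k n) n`. [cite: BarakHopkinsKelnerKothariMoitraPotechin2019, Rem. 1.2] -/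
theorem recoveryGlue_recoverProb_le_accept (A : RandAlg (List Bool) (List Bool))
    {τ : List Bool × List Bool → Bool}
    (hτs : ∀ (n : ℕ) (x : EdgeVec n) (o : List Bool),
      τ (boolPair (unaryEncodeNat n) (encodeEdgeVec x), o) = true ↔
        (Nat.log 2 n + 2) ^ 2 ≤ (decodeVertexSet n o).card ∧
          (graphOfEdgeVec x).IsClique (decodeVertexSet n o : Set (Fin n)))
    (k : ℕ → ℕ) {n : ℕ} (ht : (Nat.log 2 n + 2) ^ 2 ≤ min (k n) n) :
    recoverProb A k n ≤
      acceptProbOn (RandAlg.mk (fun w r => τ (w, A.run w r)) A.coinLen) (plantedCliqueDist n (k n)) := by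
  unfold recoverProb acceptProbOn
  rw [plantedCliqueDist, PMF.bind_map]
  refine ENNReal.toReal_mono (ne_top_of_le_ne_top ENNReal.one_ne_top ((measure_mono (Set.subset_univ _)).trans_eq
    ((PMF.toOuterMeasure_apply_eq_one_iff _ Set.univ).2 (Set.subset_univ _)))) ?_
  rw [PMF.toOuterMeasure_bind_apply, PMF.toOuterMeasure_bind_apply]
  refine ENNReal.tsum_le_tsum fun p => ?_
  by_cases hp : p ∈ (plantedCliqueJoint n (k n)).support
  · obtain ⟨hcard, hclq⟩ := mem_support_plantedCliqueJoint hp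
    refine mul_le_mul_of_nonneg_left ?_ zero_le
    rw [Function.comp_apply, PMF.toOuterMeasure_map_apply, recoveryGlue_outputPMF,
      PMF.toOuterMeasure_map_apply]
    refine measure_mono fun o ho => ?_
    have ho' : decodeVertexSet n o = p.1 := by simpa using ho
    show τ (boolPair (unaryEncodeNat n) (encodeEdgeVec p.2), o) ∈ ({true} : Set Bool)
    rw [Set.mem_singleton_iff, hτs, ho', hcard]
    exact ⟨ht, hclq⟩
  · rw [PMF.mem_support_iff, not_not] at hp
    rw [hp, zero_mul, zero_mul]

/-- **Null side**: acceptance exhibits a clique of size `t(n)` in `G(n,1/2)`, so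
`P_{G(n,1/2)}[T = 1] ≤ P[G(n,1/2) has a t(n)-clique]`. [cite: BarakHopkinsKelnerKothariMoitraPotechin2019, Rem. 1.2] -/
theorem recoveryGlue_typeI_le (A : RandAlg (List Bool) (List Bool)) {τ : List Bool × List Bool → Bool}
    (hτs : ∀ (n : ℕ) (x : EdgeVec n) (o : List Bool),
      τ (boolPair (unaryEncodeNat n) (encodeEdgeVec x), o) = true ↔
        (Nat.log 2 n + 2) ^ 2 ≤ (decodeVertexSet n o).card ∧
          (graphOfEdgeVec x).IsClique (decodeVertexSet n o : Set (Fin n)))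
    (n : ℕ) :
    acceptProbOn (RandAlg.mk (fun w r => τ (w, A.run w r)) A.coinLen) (erdosRenyiHalf n) ≤
      ((erdosRenyiHalf n).toOuterMeasure {x | ∃ S : Finset (Fin n), S.card = (Nat.log 2 n + 2) ^ 2 ∧
        (graphOfEdgeVec x).IsClique (S : Set (Fin n))}).toReal := by
  unfold acceptProbOn
  refine ENNReal.toReal_mono (ne_top_of_le_ne_top ENNReal.one_ne_top ((measure_mono (Set.subset_univ _)).trans_eq
    ((PMF.toOuterMeasure_apply_eq_one_iff _ Set.univ).2 (Set.subset_univ _)))) ?_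
  rw [PMF.toOuterMeasure_bind_apply, PMF.toOuterMeasure_apply]
  refine ENNReal.tsum_le_tsum fun G => ?_
  by_cases hG : G ∈ {x : EdgeVec n | ∃ S : Finset (Fin n), S.card = (Nat.log 2 n + 2) ^ 2 ∧
      (graphOfEdgeVec x).IsClique (S : Set (Fin n))}
  · rw [Set.indicator_of_mem hG]
    calc _ ≤ erdosRenyiHalf n G * 1 :=
          mul_le_mul_of_nonneg_left ((measure_mono (Set.subset_univ _)).trans_eq
            ((PMF.toOuterMeasure_apply_eq_one_iff _ Set.univ).2 (Set.subset_univ _))) zero_le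
      _ = erdosRenyiHalf n G := mul_one _
  · rw [Set.indicator_of_notMem hG]
    have hzero : ((RandAlg.mk (fun w r => τ (w, A.run w r)) A.coinLen).outputPMF id
        (boolPair (unaryEncodeNat n) (encodeEdgeVec G))).toOuterMeasure {true} = 0 := by
      rw [recoveryGlue_outputPMF, PMF.toOuterMeasure_map_apply]
      have hempty : (fun o => τ (boolPair (unaryEncodeNat n) (encodeEdgeVec G), o)) ⁻¹' ({true} : Set Bool) = ∅ := by
        refine Set.eq_empty_of_forall_notMem fun o ho => hG ?_
        have ho' : τ (boolPair (unaryEncodeNat n) (encodeEdgeVec G), o) = true := by simpa using ho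
        obtain ⟨hcard, hclq⟩ := (hτs n G o).1 ho'
        obtain ⟨S, hS, hScard⟩ := Finset.exists_subset_card_eq hcard
        exact ⟨S, hScard, hclq.subset (by exact_mod_cast hS)⟩
      rw [hempty, measure_empty]
    rw [hzero, mul_zero]

/-- **Corner `k ≡ 1`**: with a planted singleton the graph is `G(n,1/2)` itself and the planted vertex is
uniform and independent of everything the algorithm sees, so the recovery probability is `≤ 1/n`. [folklore] -/
theorem recoveryGlue_recoverProb_le_inv (A : RandAlg (List Bool) (List Bool)) (k : ℕ → ℕ) {n : ℕ}
    (hn : 1 ≤ n) (hk : k n = 1) : recoverProb A k n ≤ 1 / n := by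
  unfold recoverProb
  rw [hk]
  set ks : Finset (Finset (Fin n)) := kSubsets n 1 with hks
  have hks' : ks = univ.powersetCard 1 := by rw [hks, kSubsets, min_eq_left hn]
  have hcard : ks.card = n := by
    rw [hks', card_powersetCard, card_univ, Fintype.card_fin, Nat.choose_one_right]
  have hmem : ∀ S ∈ ks, S.card ≤ 1 := fun S hS => by
    rw [card_of_mem_kSubsets hS]
    exact min_le_left _ _
  set μ : EdgeVec n → PMF (List Bool) := fun x =>
    A.outputPMF id (boolPair (unaryEncodeNat n) (encodeEdgeVec x)) with hμ
  have hjoint : ((plantedCliqueJoint n 1).bind fun p =>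
      (A.outputPMF id (boolPair (unaryEncodeNat n) (encodeEdgeVec p.2))).map fun w =>
        decide (decodeVertexSet n w = p.1)) =
      (PMF.uniformOfFinset (kSubsets n 1) (kSubsets_nonempty n 1)).bind fun S =>
        (erdosRenyiHalf n).bind fun x => (μ (plant S x)).map fun w => decide (decodeVertexSet n w = S) := by
    rw [plantedCliqueJoint, PMF.bind_bind]
    congr 1
    funext S
    rw [PMF.bind_map]
    rfl
  rw [hjoint]
  -- the mass of every `S ∈ ks` summed over the disjoint events `{decode = S}` is at most `1`
  have hdisj : ∀ x : EdgeVec n, ∑ S ∈ ks, (μ x).toOuterMeasure {o | decodeVertexSet n o = S} ≤ 1 := by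
    intro x
    simp_rw [PMF.toOuterMeasure_apply]
    rw [← Summable.tsum_finsetSum (fun _ _ => ENNReal.summable)]
    calc ∑' o, ∑ S ∈ ks, ({o | decodeVertexSet n o = S} : Set (List Bool)).indicator (μ x) o
        ≤ ∑' o, μ x o := by
          refine ENNReal.tsum_le_tsum fun o => ?_
          have h : ∀ S ∈ ks, ({o | decodeVertexSet n o = S} : Set (List Bool)).indicator (μ x) o =
              if decodeVertexSet n o = S then μ x o else 0 := fun S _ => by
            by_cases h : decodeVertexSet n o = S
            · rw [if_pos h, Set.indicator_of_mem (by exact h)]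
            · rw [if_neg h, Set.indicator_of_notMem (by exact h)]
          rw [sum_congr rfl h, sum_ite_eq]
          split_ifs
          · exact le_rfl
          · exact zero_le
      _ = 1 := PMF.tsum_coe _
  have hval : ((PMF.uniformOfFinset (kSubsets n 1) (kSubsets_nonempty n 1)).bind fun S =>
      (erdosRenyiHalf n).bind fun x => (μ (plant S x)).map fun w =>
        decide (decodeVertexSet n w = S)).toOuterMeasure {true} ≤ (n : ENNReal)⁻¹ := by
    rw [PMF.toOuterMeasure_bind_apply, tsum_fintype]
    have hU : ∀ S : Finset (Fin n), PMF.uniformOfFinset (kSubsets n 1) (kSubsets_nonempty n 1) S =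
        if S ∈ ks then (ks.card : ENNReal)⁻¹ else 0 := fun S => by
      rw [PMF.uniformOfFinset_apply]
      congr
    simp_rw [hU, ite_mul, zero_mul]
    rw [sum_ite_mem, univ_inter, ← mul_sum, hcard]
    have hterm : ∀ S ∈ ks, ((erdosRenyiHalf n).bind fun x => (μ (plant S x)).map fun w =>
        decide (decodeVertexSet n w = S)).toOuterMeasure {true} =
          ∑ x, erdosRenyiHalf n x * (μ x).toOuterMeasure {o | decodeVertexSet n o = S} := by
      intro S hS
      rw [PMF.toOuterMeasure_bind_apply, tsum_fintype]
      refine sum_congr rfl fun x _ => ?_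
      rw [PlantedcliqueIndistinguishable.Negative.plant_eq_self (hmem S hS), PMF.toOuterMeasure_map_apply]
      congr 2
      ext o
      simp
    rw [sum_congr rfl hterm, sum_comm]
    calc (n : ENNReal)⁻¹ * ∑ x, ∑ S ∈ ks, erdosRenyiHalf n x * (μ x).toOuterMeasure {o | decodeVertexSet n o = S}
        = (n : ENNReal)⁻¹ * ∑ x, erdosRenyiHalf n x *
            ∑ S ∈ ks, (μ x).toOuterMeasure {o | decodeVertexSet n o = S} := by simp_rw [mul_sum]
      _ ≤ (n : ENNReal)⁻¹ * ∑ x, erdosRenyiHalf n x * 1 := by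
          gcongr with x
          exact hdisj x
      _ = (n : ENNReal)⁻¹ := by
          have hsum : ∑ x, erdosRenyiHalf n x = 1 := by
            rw [← PMF.tsum_coe (erdosRenyiHalf n), tsum_fintype]
          simp_rw [mul_one]
          rw [hsum, mul_one]
  calc _ ≤ ((n : ENNReal)⁻¹).toReal :=
        ENNReal.toReal_mono (ENNReal.inv_ne_top.2 (Nat.cast_ne_zero.2 (by omega))) hval
    _ = 1 / n := by rw [ENNReal.toReal_inv, ENNReal.toReal_natCast, one_div]

/-- `3 log₂ n ≤ (⌊log₂ n⌋ + 2)²` for `n ≥ 1`. [folklore] -/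
theorem recoveryGlue_three_logb_le {n : ℕ} (hn : 1 ≤ n) :
    (2 + 1) * Real.logb 2 (n : ℝ) ≤ (((Nat.log 2 n + 2) ^ 2 : ℕ) : ℝ) := by
  have hn0 : (0 : ℝ) < n := by exact_mod_cast hn
  have hlog2 : 0 < Real.log 2 := Real.log_pos one_lt_two
  have hlt : (n : ℝ) < (2 : ℝ) ^ (Nat.log 2 n + 1) := by exact_mod_cast Nat.lt_pow_succ_log_self one_lt_two n
  have h1 : Real.logb 2 (n : ℝ) < Nat.log 2 n + 1 := by
    rw [Real.logb, div_lt_iff₀ hlog2]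
    calc Real.log n < Real.log ((2 : ℝ) ^ (Nat.log 2 n + 1)) := Real.log_lt_log hn0 hlt
      _ = ((Nat.log 2 n + 1 : ℕ) : ℝ) * Real.log 2 := by rw [Real.log_pow]
      _ = ((Nat.log 2 n : ℝ) + 1) * Real.log 2 := by push_cast; ring
  have hL : (0 : ℝ) ≤ Nat.log 2 n := Nat.cast_nonneg _
  push_cast
  nlinarith

/-- `⌊log₂ n⌋ ≤ log n / log 2` for `n ≥ 1`. [folklore] -/
theorem recoveryGlue_natlog_le {n : ℕ} (hn : 1 ≤ n) : (Nat.log 2 n : ℝ) ≤ Real.log n / Real.log 2 := by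
  have hn0 : (0 : ℝ) < n := by exact_mod_cast hn
  have hlog2 : 0 < Real.log 2 := Real.log_pos one_lt_two
  rw [le_div_iff₀ hlog2, ← Real.log_pow]
  refine Real.log_le_log (by positivity) ?_
  exact_mod_cast Nat.pow_log_le_self 2 (by omega : n ≠ 0)

/-- Polylog versus power: `(log x / log 2 + 2)² ≤ x^c` for all large real `x` (`c > 0`). [folklore] -/
theorem recoveryGlue_eventually_log_sq_le {c : ℝ} (hc : 0 < c) :
    ∀ᶠ x : ℝ in atTop, (Real.log x / Real.log 2 + 2) ^ 2 ≤ x ^ c := by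
  have hlog2 : 0 < Real.log 2 := Real.log_pos one_lt_two
  have hlo : (fun x : ℝ => Real.log x ^ 2) =o[atTop] fun x : ℝ => x ^ c :=
    (isLittleO_log_rpow_rpow_atTop ((2 : ℕ) : ℝ) hc).congr_left fun x => Real.rpow_natCast _ _
  have hK : (0 : ℝ) < (Real.log 2 / 3) ^ 2 := by positivity
  filter_upwards [hlo.def hK, eventually_ge_atTop (2 : ℝ)] with x hx hx2
  have hx0 : (0 : ℝ) ≤ x := by linarith
  have hlx : Real.log 2 ≤ Real.log x := Real.log_le_log two_pos hx2
  rw [Real.norm_of_nonneg (sq_nonneg _), Real.norm_of_nonneg (Real.rpow_nonneg hx0 _)] at hx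
  have h1 : Real.log x / Real.log 2 + 2 ≤ 3 * Real.log x / Real.log 2 := by
    rw [div_add' _ _ _ hlog2.ne', div_le_div_iff_of_pos_right hlog2]
    linarith
  have h0 : 0 ≤ Real.log x / Real.log 2 + 2 := add_nonneg (div_nonneg (hlog2.le.trans hlx) hlog2.le) zero_le_two
  calc (Real.log x / Real.log 2 + 2) ^ 2 ≤ (3 * Real.log x / Real.log 2) ^ 2 := pow_le_pow_left₀ h0 h1 2
    _ = ((Real.log 2 / 3) ^ 2)⁻¹ * Real.log x ^ 2 := by field_simp
    _ ≤ ((Real.log 2 / 3) ^ 2)⁻¹ * ((Real.log 2 / 3) ^ 2 * x ^ c) := by gcongr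
    _ = x ^ c := by field_simp

/-- **stmt-PneNP-8689** `PlantedcliqueRecoveryGlue`: the BBH indistinguishability conjecture and the
absence of large cliques in `G(n,1/2)` imply that planted cliques of size `⌈n^{1/2-ε}⌉` cannot be recovered
by PPT algorithms with non-vanishing probability ("a recovery algorithm plus a clique check is a test").
[cite: BarakHopkinsKelnerKothariMoitraPotechin2019, Rem. 1.2] -/
theorem plantedClique_plantedcliqueRecoveryGlue_proof :
    Summit.PneNP.PneNP.Theses.PlantedClique.PlantedcliqueRecoveryGlue := by
  unfold Summit.PneNP.PneNP.Theses.PlantedClique.PlantedcliqueRecoveryGlue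
    Summit.PneNP.PneNP.Theses.PlantedClique.PlantedcliqueIndistinguishable
    Summit.PneNP.PneNP.Theses.PlantedClique.ErdosRenyiNoLargeClique
    Summit.PneNP.PneNP.Theses.PlantedClique.PlantedcliqueThesis
  intro hInd hER ε hε A hA
  have hrp0 : ∀ m, 0 ≤ recoverProb A (fun n : ℕ => ⌈(n : ℝ) ^ (1 / 2 - ε)⌉₊) m := fun m => ENNReal.toReal_nonneg
  by_cases hε2 : ε < 1 / 2
  · -- the test
    obtain ⟨τ, hτ, hτs⟩ := recoveryGlue_exists_check
    set T : RandAlg (List Bool) Bool := ⟨fun w r => τ (w, A.run w r), A.coinLen⟩ with hTdef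
    have hT : T.IsPolyTime id (fun b => [b]) := recoveryGlue_test_isPolyTime hA hτ
    set kε : ℕ → ℕ := fun n : ℕ => ⌈(n : ℝ) ^ (1 / 2 - ε)⌉₊ with hkε
    have hc : 0 < 1 / 2 - ε := by linarith
    -- asymptotic facts
    have hz : Tendsto (fun n : ℕ => (n : ℝ) ^ (ε / 2)) atTop atTop :=
      (tendsto_rpow_atTop (by linarith)).comp tendsto_natCast_atTop_atTop
    have hadm : ∃ ε' : ℝ, 0 < ε' ∧ ∀ᶠ n : ℕ in atTop, (kε n : ℝ) ≤ (n : ℝ) ^ (1 / 2 - ε') := by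
      refine ⟨ε / 2, by linarith, ?_⟩
      filter_upwards [hz.eventually_ge_atTop 2, eventually_ge_atTop 1] with n hn2 hn1
      have hn0 : (0 : ℝ) < n := by exact_mod_cast hn1
      have h1 : (1 : ℝ) ≤ (n : ℝ) ^ (1 / 2 - ε) := Real.one_le_rpow (by exact_mod_cast hn1) hc.le
      have h2 : (kε n : ℝ) < (n : ℝ) ^ (1 / 2 - ε) + 1 := Nat.ceil_lt_add_one (by positivity)
      have h3 : (n : ℝ) ^ (1 / 2 - ε / 2) = (n : ℝ) ^ (1 / 2 - ε) * (n : ℝ) ^ (ε / 2) := by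
        rw [← Real.rpow_add hn0]; ring_nf
      rw [h3]
      nlinarith
    have ht : ∀ᶠ n : ℕ in atTop, (Nat.log 2 n + 2) ^ 2 ≤ min (kε n) n := by
      filter_upwards [tendsto_natCast_atTop_atTop.eventually (recoveryGlue_eventually_log_sq_le hc),
        eventually_ge_atTop 1] with n hn hn1
      have hlog2 : 0 < Real.log 2 := Real.log_pos one_lt_two
      have h1 : (((Nat.log 2 n + 2) ^ 2 : ℕ) : ℝ) ≤ (n : ℝ) ^ (1 / 2 - ε) := by
        push_cast
        exact (pow_le_pow_left₀ (by positivity) (by linarith [recoveryGlue_natlog_le hn1]) 2).trans hn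
      refine le_min ?_ ?_
      · have h2 := h1.trans (Nat.le_ceil _)
        exact_mod_cast h2
      · have h2 : (n : ℝ) ^ (1 / 2 - ε) ≤ n := by
          conv_rhs => rw [← Real.rpow_one (n : ℝ)]
          exact Real.rpow_le_rpow_of_exponent_le (by exact_mod_cast hn1) (by linarith)
        exact_mod_cast h1.trans h2
    -- the two bounds
    have hq : Tendsto (fun n : ℕ => ((erdosRenyiHalf n).toOuterMeasure {x | ∃ S : Finset (Fin n),
        S.card = (Nat.log 2 n + 2) ^ 2 ∧ (graphOfEdgeVec x).IsClique (S : Set (Fin n))}).toReal) atTop (𝓝 0) := by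
      have h := hER (fun n => (Nat.log 2 n + 2) ^ 2) ⟨1, one_pos, ?_⟩
      · have h2 := (ENNReal.tendsto_toReal ENNReal.zero_ne_top).comp h
        rwa [ENNReal.toReal_zero] at h2
      · filter_upwards [eventually_ge_atTop 1] with n hn
        exact recoveryGlue_three_logb_le hn
    have hI := hInd kε hadm T hT
    rw [tendsto_order]
    refine ⟨fun a ha => Eventually.of_forall fun n => lt_of_lt_of_le ha (hrp0 n), fun a ha => ?_⟩
    have hη : (0 : ℝ) < a / 2 := by linarith
    filter_upwards [hI (a / 2) hη, ht, hq.eventually (gt_mem_nhds hη)] with n hIn htn hqn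
    have hP1 := recoveryGlue_recoverProb_le_accept A hτs kε htn
    have hP2 := recoveryGlue_typeI_le A hτs n
    unfold typeIError typeIIError at hIn
    change 1 - a / 2 ≤ acceptProbOn T (erdosRenyiHalf n) + (1 - acceptProbOn T (plantedCliqueDist n (kε n))) at hIn
    change recoverProb A kε n ≤ acceptProbOn T (plantedCliqueDist n (kε n)) at hP1
    change acceptProbOn T (erdosRenyiHalf n) ≤ _ at hP2
    linarith
  · -- corner `ε ≥ 1/2`: `k_ε n = 1` for `n ≥ 1`
    push Not at hε2
    have hk1 : ∀ n : ℕ, 1 ≤ n → ⌈(n : ℝ) ^ (1 / 2 - ε)⌉₊ = 1 := by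
      intro n hn
      have hn1 : (1 : ℝ) ≤ n := by exact_mod_cast hn
      have h1 : (n : ℝ) ^ (1 / 2 - ε) ≤ 1 := Real.rpow_le_one_of_one_le_of_nonpos hn1 (by linarith)
      have h2 : 0 < (n : ℝ) ^ (1 / 2 - ε) := Real.rpow_pos_of_pos (by linarith) _
      refine le_antisymm ?_ (Nat.one_le_ceil_iff.2 h2)
      exact Nat.ceil_le.2 (by simpa using h1)
    refine tendsto_of_tendsto_of_tendsto_of_le_of_le' tendsto_const_nhds tendsto_one_div_atTop_nhds_zero_nat
      (Eventually.of_forall hrp0) ?_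
    filter_upwards [eventually_ge_atTop 1] with n hn
    exact recoveryGlue_recoverProb_le_inv A _ hn (hk1 n hn)

end Summit.PneNP.PneNP.Theorems
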